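import Summits.SmoothPoincare4.SmoothPoincare4.Theses.DottedCircleRasmussen
import Summits.SmoothPoincare4.SmoothPoincare4.Theorems.DottedCircleRasmussenDcrGfgmw
import Literature.Topology.FourManifolds.MMSWRasmussenFactsProofs

/-!
# `DcrGap` — negative-side support I: normal form of the no-disc clause, load-bearing `≃ₘ`, SPC4 shield

Support lemmas for the crux `Summit.SmoothPoincare4.SmoothPoincare4.Theses.DottedCircleRasmussen.DcrGap`
(stmt-SmoothPoincare4-16128, the ONE-HANDLE SLICE GAP of route `DottedCircleRasmussen`), from the
standing disprover's work file `Cruxes/DcrGap/Disproof.lean` §§0–3 (which names the three clauses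
`IsModelKnot`, `HomotopySphereSlice`, `NoDisc`; here they are written out, so that this file is
theorems only).  Nothing here concludes the crux or any route item positively.

`DcrGap` reads: some smoothly embedded circle `K ⊂ ∂D_k` (`MMSW.IsModelKnot k K`) bounds a smooth
proper disc off the dotted handlebody `e(D_k)` inside SOME homotopy 4-sphere
(`MMSW.IsSliceDiscInComplement k K M e f`), but in NO smooth `N ≅ S⁴`, for NO chart `e'` (the
NO-DISC CLAUSE).

* §1 `noDisc_iff_forall_not_isModelSliceDisc` — NORMAL FORM: for a circle on `∂D_k`, the universal
  no-disc clause (over all carriers `N`, atlases, diffeomorphisms `N ≅ S⁴`, charts `e'`, hence both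
  chiralities) is EQUIVALENT to "`K` bounds no smooth proper disc in `ℝ⁴ ∖ D_k`"
  (`MMSW.IsModelSliceDisc`): Palais standardisation (the tree's
  `DcrGfgmw.exists_isModelSliceDisc_or_mirror_of_diffeomorph`) one way, a stereographic push
  (`MMSW.IsModelSliceDisc.isSliceDiscInComplement_chartAt_symm`) the other, the mirror absorbed by
  `MMSW.IsModelSliceDisc.modelMirror_comp`.  Whence the crux and the kill switch
  `DcrRigidity = ¬ DcrGap` in normal form (`dcrGap_iff_modelForm`, `dcrRigidity_iff_modelForm`):
  a refutation of the crux must produce MODEL slice discs, nothing less and nothing more.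
* §2 `dcrGap_false_without_diffeo` — the hypothesis `Nonempty (N ≃ₘ S⁴)` of the clause is
  load-bearing: weakened to `Nonempty (N ≃ₕ S⁴)` the crux is false (`N := M`).
* §3 `isEmpty_diffeomorph_of_witness` — the SPC4 shield: every witness is an exotic `S⁴` (and
  `SmoothPoincare4 → ¬ DcrGap` is the contrapositive of the route's certified `closes`, recorded in
  the work file only).

References: R. Palais, *Extending diffeomorphisms*, Proc. AMS 11 (1960), Thm. B [Palais1960];
M. Freedman, R. Gompf, S. Morrison, K. Walker, Quantum Topol. 1 (2010), §1
[FreedmanGompfMorrisonWalker2010]; C. Manolescu, M. Marengon, S. Sarkar, M. Willis, Duke Math. J.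
172 (2023), Lemma 8.19, Question 9.11 [ManolescuMarengonSarkarWillis2023].
-/

noncomputable section

-- The namespace is prescribed by the crux protocol (`Summit.<P>.<Sub>.Theorems.<Crux>.Negative`
-- with `P = Sub = SmoothPoincare4`), hence the duplicated component.
set_option linter.dupNamespace false

open scoped Manifold ContDiff Topology
open Function Set
open Literature.Topology.FourManifolds Literature.Topology.FourManifolds.MMSW
open Summit.SmoothPoincare4.SmoothPoincare4.Theses.DottedCircleRasmussen

namespace Summit.SmoothPoincare4.SmoothPoincare4.Theorems.DcrGap.Negative

/-! ## §1 Normal form of the no-disc clause: no model slice disc -/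

/-- **A model slice disc kills the no-disc clause.** If `K` bounds a smooth proper disc `g` in
`ℝ⁴ ∖ D_k` (`MMSW.IsModelSliceDisc k K g`), then `N := S⁴`, `e' :=` the inverse stereographic
chart at a point, `f' := e' ∘ g` is a datum the clause forbids
(`MMSW.IsModelSliceDisc.isSliceDiscInComplement_chartAt_symm`). So NO `K` with a model slice disc
is ever the witness circle of the crux. [folklore] -/
theorem not_noDisc_of_isModelSliceDisc {k : ℕ}
    {K : (Metric.sphere (0 : EuclideanSpace ℝ (Fin 2)) 1) → EuclideanSpace ℝ (Fin 4)}
    {g : EuclideanSpace ℝ (Fin 2) → EuclideanSpace ℝ (Fin 4)} (hg : IsModelSliceDisc k K g) :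
    ¬ ∀ (N : Type) [TopologicalSpace N] [T2Space N] [SecondCountableTopology N]
        [ChartedSpace (EuclideanSpace ℝ (Fin 4)) N] [IsManifold (𝓡 4) ∞ N],
        Nonempty (N ≃ₘ⟮𝓡 4, 𝓡 4⟯ (Metric.sphere (0 : EuclideanSpace ℝ (Fin 5)) 1)) →
          ∀ (e' : EuclideanSpace ℝ (Fin 4) → N) (f' : EuclideanSpace ℝ (Fin 2) → N),
            ¬ IsSliceDiscInComplement k K N e' f' := fun h =>
  h (Metric.sphere (0 : EuclideanSpace ℝ (Fin 5)) 1) ⟨Diffeomorph.refl _ _ _⟩ _ _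
    (hg.isSliceDiscInComplement_chartAt_symm ⟨EuclideanSpace.single 0 1, by simp⟩)

/-- **The mirror freedom is not exploitable**: a model slice disc for the mirror `ρ ∘ K`
(`ρ(x₀,x₁,x₂,x₃) = (x₀,-x₁,x₂,x₃)` preserves `D_k`) is reflected to one for `K`
(`MMSW.IsModelSliceDisc.modelMirror_comp`, `ρ ∘ ρ = id`). [folklore] -/
theorem isModelSliceDisc_of_mirror {k : ℕ}
    {K : (Metric.sphere (0 : EuclideanSpace ℝ (Fin 2)) 1) → EuclideanSpace ℝ (Fin 4)}
    {g : EuclideanSpace ℝ (Fin 2) → EuclideanSpace ℝ (Fin 4)}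
    (hg : IsModelSliceDisc k (modelMirror ∘ K) g) : IsModelSliceDisc k K (modelMirror ∘ g) := by
  have h2 : IsModelSliceDisc k (modelMirror ∘ (modelMirror ∘ K)) (modelMirror ∘ g) :=
    hg.modelMirror_comp
  have hK : modelMirror ∘ (modelMirror ∘ K) = K := by
    funext t
    simp [Function.comp_apply]
  rwa [hK] at h2

/-- **Standardisation**: if a circle `K ⊂ ∂D_k` bounds NO model slice disc, the no-disc clause
holds — a datum in any `N ≅ S⁴` is transported to `S⁴` and standardised by Palais' disc theorem
to a model slice disc for `K` or for `ρ ∘ K` (the tree's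
`DcrGfgmw.exists_isModelSliceDisc_or_mirror_of_diffeomorph`), and the latter reflects to one for `K`.
[cite: Palais1960, Thm. B] -/
theorem noDisc_of_forall_not_isModelSliceDisc {k : ℕ}
    {K : (Metric.sphere (0 : EuclideanSpace ℝ (Fin 2)) 1) → EuclideanSpace ℝ (Fin 4)}
    (hK : ∀ t, K t ∈ modelBoundary k) (h : ∀ g, ¬ IsModelSliceDisc k K g) :
    ∀ (N : Type) [TopologicalSpace N] [T2Space N] [SecondCountableTopology N]
      [ChartedSpace (EuclideanSpace ℝ (Fin 4)) N] [IsManifold (𝓡 4) ∞ N],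
      Nonempty (N ≃ₘ⟮𝓡 4, 𝓡 4⟯ (Metric.sphere (0 : EuclideanSpace ℝ (Fin 5)) 1)) →
        ∀ (e' : EuclideanSpace ℝ (Fin 4) → N) (f' : EuclideanSpace ℝ (Fin 2) → N),
          ¬ IsSliceDiscInComplement k K N e' f' := by
  intro N _ _ _ _ _ hN e' f' hd
  obtain ⟨Θ⟩ := hN
  obtain ⟨g, hg | hg⟩ :=
    Theorems.DcrGfgmw.exists_isModelSliceDisc_or_mirror_of_diffeomorph hK Θ hd
  · exact h g hg
  · exact h _ (isModelSliceDisc_of_mirror hg)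

/-- **NORMAL FORM OF THE NO-DISC CLAUSE.** For a circle on `∂D_k` the clause "in no `N ≅ S⁴`, for no
chart `e'`, does `e' ∘ K` bound a disc off `e'(D_k)`" is EQUIVALENT to "`K` bounds no smooth proper
disc in `ℝ⁴ ∖ D_k`" (`MMSW.IsModelSliceDisc`). All the carrier / atlas / diffeomorphism / chart /
chirality freedom of the clause is absorbed. [cite: Palais1960, Thm. B] -/
theorem noDisc_iff_forall_not_isModelSliceDisc {k : ℕ}
    {K : (Metric.sphere (0 : EuclideanSpace ℝ (Fin 2)) 1) → EuclideanSpace ℝ (Fin 4)}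
    (hK : ∀ t, K t ∈ modelBoundary k) :
    (∀ (N : Type) [TopologicalSpace N] [T2Space N] [SecondCountableTopology N]
      [ChartedSpace (EuclideanSpace ℝ (Fin 4)) N] [IsManifold (𝓡 4) ∞ N],
      Nonempty (N ≃ₘ⟮𝓡 4, 𝓡 4⟯ (Metric.sphere (0 : EuclideanSpace ℝ (Fin 5)) 1)) →
        ∀ (e' : EuclideanSpace ℝ (Fin 4) → N) (f' : EuclideanSpace ℝ (Fin 2) → N),
          ¬ IsSliceDiscInComplement k K N e' f') ↔
    ∀ g, ¬ IsModelSliceDisc k K g :=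
  ⟨fun h _ hg => not_noDisc_of_isModelSliceDisc hg h, noDisc_of_forall_not_isModelSliceDisc hK⟩

/-- **THE CRUX IN NORMAL FORM**: `DcrGap` holds iff some model knot `K ⊂ ∂D_k` is slice in the
`D_k`-complement of some homotopy 4-sphere but bounds NO smooth proper disc in `ℝ⁴ ∖ D_k`.
(The binder block and the slice datum of the item are `MMSW.IsModelKnot` /
`MMSW.IsSliceDiscInComplement` by `Iff.rfl`.) [cite: Palais1960, Thm. B] -/
theorem dcrGap_iff_modelForm :
    DcrGap ↔ ∃ (k : ℕ)
      (K : (Metric.sphere (0 : EuclideanSpace ℝ (Fin 2)) 1) → EuclideanSpace ℝ (Fin 4)),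
      IsModelKnot k K ∧
      (∃ (M : Type) (_ : TopologicalSpace M) (_ : T2Space M) (_ : SecondCountableTopology M)
          (_ : ChartedSpace (EuclideanSpace ℝ (Fin 4)) M) (_ : IsManifold (𝓡 4) ∞ M),
          Nonempty (ContinuousMap.HomotopyEquiv M (Metric.sphere (0 : EuclideanSpace ℝ (Fin 5)) 1)) ∧
            ∃ (e : EuclideanSpace ℝ (Fin 4) → M) (f : EuclideanSpace ℝ (Fin 2) → M),
              IsSliceDiscInComplement k K M e f) ∧
      ∀ g, ¬ IsModelSliceDisc k K g := by
  constructor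
  · rintro ⟨k, K, hK, hS, hN⟩
    exact ⟨k, K, hK, hS, (noDisc_iff_forall_not_isModelSliceDisc (IsModelKnot.mem hK)).1 hN⟩
  · rintro ⟨k, K, hK, hS, hN⟩
    exact ⟨k, K, hK, hS, (noDisc_iff_forall_not_isModelSliceDisc (IsModelKnot.mem hK)).2 hN⟩

/-- **THE KILL SWITCH IN NORMAL FORM** (what a refutation of the crux must deliver): `¬ DcrGap`
(the route's `DcrRigidity`, by name) iff every model knot that is slice in the `D_k`-complement of
some homotopy 4-sphere bounds a smooth proper disc in `ℝ⁴ ∖ D_k`. [cite: Palais1960, Thm. B] -/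
theorem dcrRigidity_iff_modelForm :
    ¬ DcrGap ↔ ∀ (k : ℕ)
      (K : (Metric.sphere (0 : EuclideanSpace ℝ (Fin 2)) 1) → EuclideanSpace ℝ (Fin 4)),
      IsModelKnot k K →
      (∃ (M : Type) (_ : TopologicalSpace M) (_ : T2Space M) (_ : SecondCountableTopology M)
          (_ : ChartedSpace (EuclideanSpace ℝ (Fin 4)) M) (_ : IsManifold (𝓡 4) ∞ M),
          Nonempty (ContinuousMap.HomotopyEquiv M (Metric.sphere (0 : EuclideanSpace ℝ (Fin 5)) 1)) ∧
            ∃ (e : EuclideanSpace ℝ (Fin 4) → M) (f : EuclideanSpace ℝ (Fin 2) → M),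
              IsSliceDiscInComplement k K M e f) →
      ∃ g, IsModelSliceDisc k K g := by
  rw [dcrGap_iff_modelForm]
  simp only [not_exists, not_and, not_forall, not_not]

/-! ## §2 `Nonempty (N ≃ₘ S⁴)` is load-bearing -/

/-- **`Nonempty (N ≃ₘ S⁴)` is load-bearing**: with the diffeomorphism hypothesis of the no-disc
clause WEAKENED to a homotopy equivalence `N ≃ₕ S⁴`, the crux is FALSE — the witnessing homotopy
sphere `M` is itself an admissible `N` and its datum `(e, f)` violates the clause. (So the gap, if
it exists, is invisible to anything that does not see the smooth structure of `N`; any proof of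
the crux must use `≃ₘ`, not merely `≃ₕ`.) [folklore] -/
theorem dcrGap_false_without_diffeo :
    ¬ ∃ (k : ℕ)
      (K : (Metric.sphere (0 : EuclideanSpace ℝ (Fin 2)) 1) → EuclideanSpace ℝ (Fin 4)),
      IsModelKnot k K ∧
      (∃ (M : Type) (_ : TopologicalSpace M) (_ : T2Space M) (_ : SecondCountableTopology M)
          (_ : ChartedSpace (EuclideanSpace ℝ (Fin 4)) M) (_ : IsManifold (𝓡 4) ∞ M),
          Nonempty (ContinuousMap.HomotopyEquiv M (Metric.sphere (0 : EuclideanSpace ℝ (Fin 5)) 1)) ∧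
            ∃ (e : EuclideanSpace ℝ (Fin 4) → M) (f : EuclideanSpace ℝ (Fin 2) → M),
              IsSliceDiscInComplement k K M e f) ∧
      ∀ (N : Type) [TopologicalSpace N] [T2Space N] [SecondCountableTopology N]
        [ChartedSpace (EuclideanSpace ℝ (Fin 4)) N] [IsManifold (𝓡 4) ∞ N],
        Nonempty (ContinuousMap.HomotopyEquiv N (Metric.sphere (0 : EuclideanSpace ℝ (Fin 5)) 1)) →
          ∀ (e' : EuclideanSpace ℝ (Fin 4) → N) (f' : EuclideanSpace ℝ (Fin 2) → N),
            ¬ IsSliceDiscInComplement k K N e' f' := by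
  rintro ⟨k, K, -, ⟨M, _, _, _, _, _, hM, e, f, hef⟩, hno⟩
  exact hno M hM e f hef

/-! ## §3 The SPC4 shield: witnesses are exotic -/

/-- **Every witness of the crux is an exotic 4-sphere**: if `K` satisfies the no-disc clause, a
4-manifold `M` carrying a slice datum for `K` admits no diffeomorphism to `S⁴` (else `N := M`
violates the clause). [cite: FreedmanGompfMorrisonWalker2010, §1] -/
theorem isEmpty_diffeomorph_of_witness {k : ℕ}
    {K : (Metric.sphere (0 : EuclideanSpace ℝ (Fin 2)) 1) → EuclideanSpace ℝ (Fin 4)}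
    (hno : ∀ (N : Type) [TopologicalSpace N] [T2Space N] [SecondCountableTopology N]
      [ChartedSpace (EuclideanSpace ℝ (Fin 4)) N] [IsManifold (𝓡 4) ∞ N],
      Nonempty (N ≃ₘ⟮𝓡 4, 𝓡 4⟯ (Metric.sphere (0 : EuclideanSpace ℝ (Fin 5)) 1)) →
        ∀ (e' : EuclideanSpace ℝ (Fin 4) → N) (f' : EuclideanSpace ℝ (Fin 2) → N),
          ¬ IsSliceDiscInComplement k K N e' f')
    {M : Type} [TopologicalSpace M] [T2Space M] [SecondCountableTopology M]
    [ChartedSpace (EuclideanSpace ℝ (Fin 4)) M] [IsManifold (𝓡 4) ∞ M]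
    {e : EuclideanSpace ℝ (Fin 4) → M} {f : EuclideanSpace ℝ (Fin 2) → M}
    (hef : IsSliceDiscInComplement k K M e f) :
    IsEmpty (M ≃ₘ⟮𝓡 4, 𝓡 4⟯ (Metric.sphere (0 : EuclideanSpace ℝ (Fin 5)) 1)) :=
  ⟨fun Φ => hno M ⟨Φ⟩ e f hef⟩

end Summit.SmoothPoincare4.SmoothPoincare4.Theorems.DcrGap.Negative

end
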